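import Mathlib
import Summits.NavierStokesRegularity.NavierStokesRegularity.Theses.HalfSpaceWindowDoor
import HarnessLib

/-!
# `HalfSpaceWindowDoor.Assembly` — the route's assembly (item stmt-NavierStokesRegularity-25313;
  pure logic)

**Statement.** `HalfSpaceZoom → CirculationCarryingRigidity → PoloidalWindowRigidity → Target`
(the rung leaf of the closed-hemisphere window door).

PROOF. The route file `Theses/HalfSpaceWindowDoor.lean` carries the planner-authored,
kernel-checked deciding theorem `Theses.HalfSpaceWindowDoor.closes` (hypotheses: the two cruxes
and the zoom support; conclusion: `Target`): at a point that is not backward bounded the zoom gives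
a Type-I ancient Oseen-mild profile whose `e`-vorticity is one-signed; either it is somewhere
positive (`CirculationCarryingRigidity`) or it vanishes identically (`PoloidalWindowRigidity`), and
both deny the backward singularity. The assembly item is that implication written as ONE
proposition (hypotheses in the item's order), so it is closed by applying `closes`.

HONEST FRAMING: glue between the route's own statements about a HYPOTHETICAL Type-I profile; the
two cruxes are OPEN (XL) and stay hypotheses; the door is a criterion, not a regularity theorem.
Nothing here proves or refutes Navier–Stokes regularity.
-/

noncomputable section

set_option linter.dupNamespace false

namespace Summit.NavierStokesRegularity.NavierStokesRegularity.Theorems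

open Summit.NavierStokesRegularity.NavierStokesRegularity.Theses.HalfSpaceWindowDoor in
/-- **Item stmt-NavierStokesRegularity-25313** (`HalfSpaceWindowDoor.Assembly`): the route's zoom
support and two cruxes imply its rung leaf `Target`, by the route file's deciding theorem
`closes`. [this file] -/
theorem halfSpaceWindowDoor_assembly_proof :
    Summit.NavierStokesRegularity.NavierStokesRegularity.Theses.HalfSpaceWindowDoor.Assembly := by
  unfold Summit.NavierStokesRegularity.NavierStokesRegularity.Theses.HalfSpaceWindowDoor.Assembly
  intro h₉ h₂ h₃
  exact closes h₂ h₃ h₉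

end Summit.NavierStokesRegularity.NavierStokesRegularity.Theorems

end
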